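import Summits.Ventures.PercRepro.TriangleCapBridgeSelf

/-!
# PercRepro — the triangle cap at nullity `≤ 3` is a kernel theorem: `HypergraphBound 0 0`, `1 1`, `2 2`, `3 4` (p3 g21)

The first three rows of the table `P(ν) = 1, 2, 4, 5, 7, 10, 11, 13` are proved by hand: in a linear `3`-uniform
hypergraph any three distinct members `t₁, t₂, t₃`, in this growth order, each bring a new point (`t₂ ⊄ t₁` as both
have `3` points, and `t₃` meets `t₁ ∪ t₂` in at most `2` points), so the list `[t₃, t₂, t₁]` has growth count `3`;
hence `GrowthLE H d` forces `|H| ≤ d` for `d ≤ 2`.  `P(3) = 4`: with growth count `≤ 3` a fourth member lies in the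
union of any three others and so meets each of them in exactly one point; with five members, pigeonhole gives a
point `p` on three members `a, b, c`; the other two members `d, e` avoid `p` (else `d ∩ (a ∪ b ∪ c) = {p}`), their
common point `x` lies on one of `a, b, c`, say `t`, and the growth order `d, e, t', t` (`t'` another of `a, b, c`)
counts four: `t'` brings `p`, and `t ∩ (d ∪ e ∪ t') ⊆ {x, p}` has two points.  With
`ncard_triangles_le_of_hypergraphBound_of_free` these are `s₃ ≤ 0 / 1 / 2 / 4` on the e-free core of nullity
`0 / 1 / 2 / 3` — sanity instances of the bridge, not levers of the cell (the rows the cell needs are `P(6) = 10`,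
`P(7) = 11`, `P(8) = 13`, computed).

* `not_subset_of_card_inter_le_one` — a `3`-set meeting two sets in `≤ 1` point each is not inside their union;
* `newCountF_three` — three distinct members give growth count `3`;
* `hypergraphBound_zero`, `hypergraphBound_one`, `hypergraphBound_two` — `HypergraphBound d d` for `d ≤ 2`;
* `subset_union_three_of_growthLE_three`, `card_inter_eq_one_of_growthLE_three`, `newCountF_four_of_growthLE_three`,
  **`hypergraphBound_three`** — `HypergraphBound 3 4`;
* `ncard_triangles_le_two_of_free`, `ncard_triangles_le_four_of_free` — the bridge applied at nullity `2` and `3`.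
Axioms: standard.
-/

namespace PercRepro

namespace TriangleCap

variable {β : Type} [DecidableEq β]

/-- A `3`-point set meeting each of two sets in at most one point is not contained in their union. -/
theorem not_subset_of_card_inter_le_one {t t₁ t₂ : Finset β} (ht : t.card = 3)
    (h₁ : (t ∩ t₁).card ≤ 1) (h₂ : (t ∩ t₂).card ≤ 1) : ¬ t ⊆ t₁ ∪ t₂ := by
  intro hsub
  have hcard : t.card ≤ (t ∩ t₁).card + (t ∩ t₂).card := by
    calc t.card = (t ∩ (t₁ ∪ t₂)).card := by rw [Finset.inter_eq_left.2 hsub]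
      _ = ((t ∩ t₁) ∪ (t ∩ t₂)).card := by rw [Finset.inter_union_distrib_left]
      _ ≤ (t ∩ t₁).card + (t ∩ t₂).card := Finset.card_union_le _ _
  omega

/-- A member with `3` points is not inside a set with at most `1` common point. -/
theorem not_subset_of_card_inter_le_one' {t t₁ : Finset β} (ht : t.card = 3)
    (h₁ : (t ∩ t₁).card ≤ 1) : ¬ t ⊆ t₁ := by
  intro hsub
  have : (t ∩ t₁).card = 3 := by rw [Finset.inter_eq_left.2 hsub, ht]
  omega

/-- Three distinct members of a linear `3`-uniform hypergraph, added in the order `t₁, t₂, t₃`, each bring a new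
point: `newCountF [t₃, t₂, t₁] = 3`. -/
theorem newCountF_three {H : Finset (Finset β)} (hlin : IsLinear3 H) {t₁ t₂ t₃ : Finset β}
    (h₁ : t₁ ∈ H) (h₂ : t₂ ∈ H) (h₃ : t₃ ∈ H) (h₁₂ : t₁ ≠ t₂) (h₁₃ : t₁ ≠ t₃) (h₂₃ : t₂ ≠ t₃) :
    newCountF [t₃, t₂, t₁] = 3 := by
  have hc₁ := hlin.1 t₁ h₁
  have hc₂ := hlin.1 t₂ h₂
  have hc₃ := hlin.1 t₃ h₃
  have hi₂₁ : (t₂ ∩ t₁).card ≤ 1 := hlin.2 t₂ h₂ t₁ h₁ h₁₂.symm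
  have hi₃₂ : (t₃ ∩ t₂).card ≤ 1 := hlin.2 t₃ h₃ t₂ h₂ h₂₃.symm
  have hi₃₁ : (t₃ ∩ t₁).card ≤ 1 := hlin.2 t₃ h₃ t₁ h₁ h₁₃.symm
  have hn₁ : ¬ t₁ ⊆ unionF [] := by
    rw [unionF_nil, Finset.subset_empty]
    intro h
    rw [h, Finset.card_empty] at hc₁
    omega
  have hn₂ : ¬ t₂ ⊆ unionF [t₁] := by
    rw [unionF_cons, unionF_nil, Finset.union_empty]
    exact not_subset_of_card_inter_le_one' hc₂ hi₂₁
  have hn₃ : ¬ t₃ ⊆ unionF [t₂, t₁] := by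
    rw [unionF_cons, unionF_cons, unionF_nil, Finset.union_empty]
    exact not_subset_of_card_inter_le_one hc₃ hi₃₂ hi₃₁
  rw [newCountF_cons, newCountF_cons, newCountF_cons, newCountF_nil, if_neg hn₁, if_neg hn₂, if_neg hn₃]

/-- Any two distinct members give growth count `2`. -/
theorem newCountF_two {H : Finset (Finset β)} (hlin : IsLinear3 H) {t₁ t₂ : Finset β}
    (h₁ : t₁ ∈ H) (h₂ : t₂ ∈ H) (h₁₂ : t₁ ≠ t₂) : newCountF [t₂, t₁] = 2 := by
  have hc₁ := hlin.1 t₁ h₁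
  have hc₂ := hlin.1 t₂ h₂
  have hi₂₁ : (t₂ ∩ t₁).card ≤ 1 := hlin.2 t₂ h₂ t₁ h₁ h₁₂.symm
  have hn₁ : ¬ t₁ ⊆ unionF [] := by
    rw [unionF_nil, Finset.subset_empty]
    intro h
    rw [h, Finset.card_empty] at hc₁
    omega
  have hn₂ : ¬ t₂ ⊆ unionF [t₁] := by
    rw [unionF_cons, unionF_nil, Finset.union_empty]
    exact not_subset_of_card_inter_le_one' hc₂ hi₂₁
  rw [newCountF_cons, newCountF_cons, newCountF_nil, if_neg hn₁, if_neg hn₂]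

/-- Any member gives growth count `1`. -/
theorem newCountF_one {H : Finset (Finset β)} (hlin : IsLinear3 H) {t₁ : Finset β} (h₁ : t₁ ∈ H) :
    newCountF [t₁] = 1 := by
  have hc₁ := hlin.1 t₁ h₁
  have hn₁ : ¬ t₁ ⊆ unionF [] := by
    rw [unionF_nil, Finset.subset_empty]
    intro h
    rw [h, Finset.card_empty] at hc₁
    omega
  rw [newCountF_cons, newCountF_nil, if_neg hn₁]

/-- `P(0) = 0`: a linear `3`-uniform hypergraph with growth count `0` is empty. -/
theorem hypergraphBound_zero : HypergraphBound 0 0 := by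
  intro β _ H hlin hgr _ _ _
  by_contra hne
  have hlt : 0 < H.card := by omega
  obtain ⟨t, ht⟩ : H.Nonempty := Finset.card_pos.1 hlt
  have h := hgr [t] (by simpa using ht)
  rw [newCountF_one hlin ht] at h
  omega

/-- `P(1) = 1`: with growth count `≤ 1` there is at most one member. -/
theorem hypergraphBound_one : HypergraphBound 1 1 := by
  intro β _ H hlin hgr _ _ _
  by_contra hne
  have hlt : 1 < H.card := by omega
  obtain ⟨t₁, t₂, h₁, h₂, h₁₂⟩ := Finset.one_lt_card_iff.1 hlt
  have h := hgr [t₂, t₁] (by simp [h₁, h₂])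
  rw [newCountF_two hlin h₁ h₂ h₁₂] at h
  omega

/-- `P(2) = 2`: with growth count `≤ 2` there are at most two members. -/
theorem hypergraphBound_two : HypergraphBound 2 2 := by
  intro β _ H hlin hgr _ _ _
  by_contra hne
  have hlt : 2 < H.card := by omega
  obtain ⟨t₁, t₂, t₃, h₁, h₂, h₃, h₁₂, h₁₃, h₂₃⟩ := Finset.two_lt_card_iff.1 hlt
  have h := hgr [t₃, t₂, t₁] (by simp [h₁, h₂, h₃])
  rw [newCountF_three hlin h₁ h₂ h₃ h₁₂ h₁₃ h₂₃] at h
  omega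

/-- With growth count `≤ 3`, a member lies in the union of any three other distinct members. -/
theorem subset_union_three_of_growthLE_three {H : Finset (Finset β)} (hlin : IsLinear3 H)
    (hgr : GrowthLE H 3) {a b c d : Finset β} (ha : a ∈ H) (hb : b ∈ H) (hc : c ∈ H) (hd : d ∈ H)
    (hab : a ≠ b) (hac : a ≠ c) (hbc : b ≠ c) : d ⊆ c ∪ (b ∪ a) := by
  by_contra hsub
  have h := hgr [d, c, b, a] (by simp [ha, hb, hc, hd])
  have hn : ¬ d ⊆ unionF [c, b, a] := by
    rwa [unionF_cons, unionF_cons, unionF_cons, unionF_nil, Finset.union_empty]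
  rw [newCountF_cons, newCountF_three hlin ha hb hc hab hac hbc, if_neg hn] at h
  omega

/-- With growth count `≤ 3`, four distinct members pairwise meet in exactly one point. -/
theorem card_inter_eq_one_of_growthLE_three {H : Finset (Finset β)} (hlin : IsLinear3 H)
    (hgr : GrowthLE H 3) {a b c d : Finset β} (ha : a ∈ H) (hb : b ∈ H) (hc : c ∈ H) (hd : d ∈ H)
    (hab : a ≠ b) (hac : a ≠ c) (hbc : b ≠ c) (hda : d ≠ a) (hdb : d ≠ b) (hdc : d ≠ c) :
    (d ∩ a).card = 1 := by
  have hsub := subset_union_three_of_growthLE_three hlin hgr ha hb hc hd hab hac hbc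
  have h3 := hlin.1 d hd
  have hdc' : (d ∩ c).card ≤ 1 := hlin.2 d hd c hc hdc
  have hdb' : (d ∩ b).card ≤ 1 := hlin.2 d hd b hb hdb
  have hda' : (d ∩ a).card ≤ 1 := hlin.2 d hd a ha hda
  have hcard : d.card ≤ (d ∩ c).card + ((d ∩ b).card + (d ∩ a).card) := by
    calc d.card = (d ∩ (c ∪ (b ∪ a))).card := by rw [Finset.inter_eq_left.2 hsub]
      _ = ((d ∩ c) ∪ (d ∩ (b ∪ a))).card := by rw [Finset.inter_union_distrib_left]
      _ ≤ (d ∩ c).card + (d ∩ (b ∪ a)).card := Finset.card_union_le _ _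
      _ = (d ∩ c).card + ((d ∩ b) ∪ (d ∩ a)).card := by rw [Finset.inter_union_distrib_left]
      _ ≤ (d ∩ c).card + ((d ∩ b).card + (d ∩ a).card) :=
          Nat.add_le_add_left (Finset.card_union_le _ _) _
  omega

/-- The growth order `d, e, t', t` counts four when `p ∈ t ∩ t'` is off `d ∪ e`, `t` meets `d` and `e` in the
same point `x`, and all intersections are single points. -/
theorem newCountF_four_of_growthLE_three {H : Finset (Finset β)} (hlin : IsLinear3 H)
    {t t' d e : Finset β} (ht : t ∈ H) (ht' : t' ∈ H) (hd : d ∈ H) (he : e ∈ H)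
    (htt' : t ≠ t') (htd : t ≠ d) (hte : t ≠ e) (hde : d ≠ e) {p x : β}
    (hpt : p ∈ t) (hpt' : p ∈ t') (hpd : p ∉ d) (hpe : p ∉ e) (hxt : x ∈ t) (hxd : x ∈ d) (hxe : x ∈ e) :
    newCountF [t, t', e, d] = 4 := by
  have hc := hlin.1 t ht
  have htt'1 : (t ∩ t').card ≤ 1 := hlin.2 t ht t' ht' htt'
  have htd1 : (t ∩ d).card ≤ 1 := hlin.2 t ht d hd htd
  have hte1 : (t ∩ e).card ≤ 1 := hlin.2 t ht e he hte
  have hn₁ : ¬ t' ⊆ unionF [e, d] := by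
    rw [unionF_cons, unionF_cons, unionF_nil, Finset.union_empty]
    intro hsub
    have := hsub hpt'
    rw [Finset.mem_union] at this
    tauto
  have hn₂ : ¬ t ⊆ unionF [t', e, d] := by
    rw [unionF_cons, unionF_cons, unionF_cons, unionF_nil, Finset.union_empty]
    intro hsub
    -- `t ⊆ {x, p}`
    have hsub2 : t ⊆ {x, p} := by
      intro z hz
      have hz' := hsub hz
      rw [Finset.mem_union, Finset.mem_union] at hz'
      rw [Finset.mem_insert, Finset.mem_singleton]
      rcases hz' with hz' | hz' | hz'
      · right
        exact Finset.card_le_one.1 htt'1 z (Finset.mem_inter.2 ⟨hz, hz'⟩) p (Finset.mem_inter.2 ⟨hpt, hpt'⟩)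
      · left
        exact Finset.card_le_one.1 hte1 z (Finset.mem_inter.2 ⟨hz, hz'⟩) x (Finset.mem_inter.2 ⟨hxt, hxe⟩)
      · left
        exact Finset.card_le_one.1 htd1 z (Finset.mem_inter.2 ⟨hz, hz'⟩) x (Finset.mem_inter.2 ⟨hxt, hxd⟩)
    have := (Finset.card_le_card hsub2).trans (Finset.card_le_two)
    omega
  rw [newCountF_cons, newCountF_cons, newCountF_two hlin hd he hde, if_neg hn₁, if_neg hn₂]

/-- `P(3) = 4`: with growth count `≤ 3` there are at most four members. -/
theorem hypergraphBound_three : HypergraphBound 3 4 := by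
  intro β _ H hlin hgr _ _ _
  by_contra hne
  have h5 : 5 ≤ H.card := by omega
  obtain ⟨a, ha⟩ : H.Nonempty := Finset.card_pos.1 (by omega)
  have ha3 := hlin.1 a ha
  set H' := H.erase a with hH'
  have hH'card : 4 ≤ H'.card := by rw [hH', Finset.card_erase_of_mem ha]; omega
  -- every other member meets `a` in exactly one point
  have hone : ∀ t ∈ H', (t ∩ a).card = 1 := by
    intro t ht
    have ht' := Finset.mem_erase.1 ht
    have h2 : 1 < (H'.erase t).card := by rw [Finset.card_erase_of_mem ht]; omega
    obtain ⟨b, c, hb, hc, hbc⟩ := Finset.one_lt_card_iff.1 h2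
    have hb' := Finset.mem_erase.1 hb
    have hc' := Finset.mem_erase.1 hc
    have hbH := Finset.mem_erase.1 hb'.2
    have hcH := Finset.mem_erase.1 hc'.2
    exact card_inter_eq_one_of_growthLE_three hlin hgr ha hbH.2 hcH.2 ht'.2
      hbH.1.symm hcH.1.symm hbc ht'.1 hb'.1.symm hc'.1.symm
  -- pigeonhole: two other members meet `a` at the same point `p`
  obtain ⟨a0, ha0⟩ : a.Nonempty := Finset.card_pos.1 (by omega)
  classical
  let f : Finset β → β := fun t => if h : (t ∩ a).Nonempty then h.choose else a0
  have hf : ∀ t ∈ H', f t ∈ t ∩ a := by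
    intro t ht
    have hne' : (t ∩ a).Nonempty := Finset.card_pos.1 (by rw [hone t ht]; omega)
    simp only [f, dif_pos hne']
    exact hne'.choose_spec
  have hmaps : Set.MapsTo f (H' : Set (Finset β)) (a : Set β) :=
    fun t ht => (Finset.mem_inter.1 (hf t ht)).2
  obtain ⟨b, hb, c, hc, hbc, hfbc⟩ :=
    Finset.exists_ne_map_eq_of_card_lt_of_maps_to (by omega : a.card < H'.card) hmaps
  set p := f b with hp
  have hpb : p ∈ b := (Finset.mem_inter.1 (hf b hb)).1
  have hpa : p ∈ a := (Finset.mem_inter.1 (hf b hb)).2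
  have hpc : p ∈ c := by rw [hfbc]; exact (Finset.mem_inter.1 (hf c hc)).1
  have hbH := Finset.mem_erase.1 hb
  have hcH := Finset.mem_erase.1 hc
  -- two further members `d ≠ e`
  have h2 : 1 < ((H'.erase b).erase c).card := by
    rw [Finset.card_erase_of_mem (Finset.mem_erase.2 ⟨hbc.symm, hc⟩), Finset.card_erase_of_mem hb]
    omega
  obtain ⟨d, e, hd, he, hde⟩ := Finset.one_lt_card_iff.1 h2
  have hd' := Finset.mem_erase.1 hd
  have hd'' := Finset.mem_erase.1 hd'.2
  have hdH := Finset.mem_erase.1 hd''.2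
  have he' := Finset.mem_erase.1 he
  have he'' := Finset.mem_erase.1 he'.2
  have heH := Finset.mem_erase.1 he''.2
  -- names: a b c d e ∈ H, pairwise distinct
  have hab : a ≠ b := hbH.1.symm
  have hac : a ≠ c := hcH.1.symm
  have hda : d ≠ a := hdH.1
  have hdb : d ≠ b := hd''.1
  have hdc : d ≠ c := hd'.1
  have hea : e ≠ a := heH.1
  have heb : e ≠ b := he''.1
  have hec : e ≠ c := he'.1
  -- a further member avoids `p`
  have havoid : ∀ g ∈ H, g ≠ a → g ≠ b → g ≠ c → p ∉ g := by
    intro g hg hga hgb hgc hpg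
    have hsub := subset_union_three_of_growthLE_three hlin hgr ha hbH.2 hcH.2 hg hab hac hbc
    have hga1 : (g ∩ a).card ≤ 1 := hlin.2 g hg a ha hga
    have hgb1 : (g ∩ b).card ≤ 1 := hlin.2 g hg b hbH.2 hgb
    have hgc1 : (g ∩ c).card ≤ 1 := hlin.2 g hg c hcH.2 hgc
    have hsub2 : g ⊆ {p} := by
      intro z hz
      have hz' := hsub hz
      rw [Finset.mem_union, Finset.mem_union] at hz'
      rw [Finset.mem_singleton]
      rcases hz' with hz' | hz' | hz'
      · exact Finset.card_le_one.1 hgc1 z (Finset.mem_inter.2 ⟨hz, hz'⟩) p (Finset.mem_inter.2 ⟨hpg, hpc⟩)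
      · exact Finset.card_le_one.1 hgb1 z (Finset.mem_inter.2 ⟨hz, hz'⟩) p (Finset.mem_inter.2 ⟨hpg, hpb⟩)
      · exact Finset.card_le_one.1 hga1 z (Finset.mem_inter.2 ⟨hz, hz'⟩) p (Finset.mem_inter.2 ⟨hpg, hpa⟩)
    have := (Finset.card_le_card hsub2).trans (Finset.card_singleton p).le
    have := hlin.1 g hg
    omega
  have hpd : p ∉ d := havoid d hdH.2 hda hdb hdc
  have hpe : p ∉ e := havoid e heH.2 hea heb hec
  -- the common point `x` of `d` and `e`
  have hde1 : (d ∩ e).card = 1 :=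
    card_inter_eq_one_of_growthLE_three hlin hgr heH.2 ha hbH.2 hdH.2 hea heb hab hde hda hdb
  obtain ⟨x, hx⟩ := Finset.card_eq_one.1 hde1
  have hxd : x ∈ d := (Finset.mem_inter.1 (hx ▸ Finset.mem_singleton_self x)).1
  have hxe : x ∈ e := (Finset.mem_inter.1 (hx ▸ Finset.mem_singleton_self x)).2
  have hxsub := subset_union_three_of_growthLE_three hlin hgr ha hbH.2 hcH.2 hdH.2 hab hac hbc hxd
  rw [Finset.mem_union, Finset.mem_union] at hxsub
  -- the growth order `d, e, t', t` with `x ∈ t`, `t' ≠ t` among `a, b, c`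
  rcases hxsub with hxc | hxb | hxa
  · have h := hgr [c, a, e, d] (by simp [ha, hcH.2, hdH.2, heH.2])
    rw [newCountF_four_of_growthLE_three hlin hcH.2 ha hdH.2 heH.2 hac.symm hdc.symm hec.symm hde
      hpc hpa hpd hpe hxc hxd hxe] at h
    omega
  · have h := hgr [b, a, e, d] (by simp [ha, hbH.2, hdH.2, heH.2])
    rw [newCountF_four_of_growthLE_three hlin hbH.2 ha hdH.2 heH.2 hab.symm hdb.symm heb.symm hde
      hpb hpa hpd hpe hxb hxd hxe] at h
    omega
  · have h := hgr [a, b, e, d] (by simp [ha, hbH.2, hdH.2, heH.2])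
    rw [newCountF_four_of_growthLE_three hlin ha hbH.2 hdH.2 heH.2 hab hda.symm hea.symm hde
      hpa hpb hpd hpe hxa hxd hxe] at h
    omega

/-- The bridge applied to `P(3) = 4`: an e-free core of nullity `3` has at most four triangles. -/
theorem ncard_triangles_le_four_of_free {α : Type} (M : Matroid α) [M.Finite]
    (hfree : ∀ e ∈ M.E, ∃ A ⊆ M.E \ {e}, e ∉ M.closure A ∧ e ∉ M.closure ((M.E \ {e}) \ A))
    (hd : M.E.encard = M.eRank + 3) : (ThmN.triangles M).ncard ≤ 4 :=
  ncard_triangles_le_of_hypergraphBound_of_free M hfree hd hypergraphBound_three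

/-- The bridge applied to `P(2) = 2`: an e-free core of nullity `2` has at most two triangles. -/
theorem ncard_triangles_le_two_of_free {α : Type} (M : Matroid α) [M.Finite]
    (hfree : ∀ e ∈ M.E, ∃ A ⊆ M.E \ {e}, e ∉ M.closure A ∧ e ∉ M.closure ((M.E \ {e}) \ A))
    (hd : M.E.encard = M.eRank + 2) : (ThmN.triangles M).ncard ≤ 2 :=
  ncard_triangles_le_of_hypergraphBound_of_free M hfree hd hypergraphBound_two

end TriangleCap

end PercRepro
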